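/-
Literature/AlgebraicGeometry/ComplexMultiplication/CyclotomicDegreeLeTwentyTwoHodgeConjectureComplete.lean — pub-hodgecm2 (COR-CM), KEPT Literature
lane lit-deligne-3 gen 63, file F63c.  THEOREMS ONLY (no `def`, no named fact, no `sorry`, no instance, no notation; D-0026 net debt 0).  HC_CM is NOT proved.
-/
import Literature.Geometry.Kaehler.CyclotomicDegreeLeSixteenHodgeConjectureComplete
import Literature.AlgebraicGeometry.ComplexMultiplication.AbelianNonCyclicDegreeFourTimesPrimeCMTypes
import Literature.AlgebraicGeometry.Pohlmann1968.DegenerateCMTypesCyclicCMFieldPrimeSquare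
import HarnessLib

/-!
# The cyclotomic fields of degree `≤ 22`, COMPLETE: for every abelian variety with complex multiplication by `ℚ(ζ_d)`,
# `φ(d) ≤ 22`, EITHER the Hodge conjecture holds for all its powers (with `B• = D•`), OR it is a SIMPLE variety of one of four
# explicit kinds carrying Hodge classes not generated by divisors: `d ∈ {21,28,36,42}` (sixfolds, `B³ ≠ D³`),
# `d ∈ {32,40,48,60}` (`8`-folds, `B⁴ ≠ D⁴` or `B² ≠ D²`), `d ∈ {19,27,38,54}` (`9`-folds of rank `8`, `B³ ≠ D³`),
# `d ∈ {33,44,66}` (`10`-folds of rank `10`, Weil type `(5,d')` over an imaginary quadratic subfield, `B⁵ = D⁵ ⊔ W ≠ D⁵`)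

Topic `Literature/AlgebraicGeometry/ComplexMultiplication`; cell `pub-hodgecm2` (COR-CM), KEPT Literature lane lit-deligne-3 (gen 63, file F63c:
the assembly «`φ(d) ≤ 22` COMPLETE» of the lane's outlook).  It extends lit-hodgefound's
`Geometry/Kaehler/CyclotomicDegreeLeSixteenHodgeConjectureComplete` (`φ(d) ≤ 16`, imported BY NAME) by the levels `16 < φ(d) ≤ 22`:

* `φ(d) = 18 ⟺ d ∈ {19, 27, 38, 54}` (§1 `totient_eq_eighteen_iff`): `ℚ(ζ₁₉) = ℚ(ζ₃₈)`, `ℚ(ζ₂₇) = ℚ(ζ₅₄)`, cyclic Galois group of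
  order `18 = 2·3²` — the tree's `Pohlmann1968/DegenerateCMTypesCyclicCMFieldPrimeSquare` §8 (Dodson's dimension `9`: the Hodge
  conjecture for all powers, or simple of rank `8` with a rational `(3,3)`-class outside `D³ ⊗ ℂ`; Serre's type, Gordon 9.4.2).
* `φ(d) = 20 ⟺ d ∈ {25, 33, 44, 50, 66}` (`totient_eq_twenty_iff`): `ℚ(ζ₂₅) = ℚ(ζ₅₀)` has CYCLIC Galois group of order `20 = 2²·5`
  — the lane's `CyclicTwoPowerTimesPrimeCMTypes` (every type: Hodge conjecture for all powers, unconditionally); `ℚ(ζ₃₃) = ℚ(ζ₆₆)`,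
  `ℚ(ζ₄₄)` have Galois group `ℤ/2 × ℤ/10` — the lane's `AbelianNonCyclicDegreeFourTimesPrimeCMTypes` (corank `≤ 1`; the trichotomy).
* `φ(d) = 22 ⟺ d ∈ {23, 46}` (`totient_eq_twentyTwo_iff`): `ℚ(ζ₂₃)`, cyclic of order `22 = 2·11` (`CyclicTwoPowerTimesPrimeCMTypes`
  with `k = 0`, the Tankeev–Ribet–Yanai prime case: all powers, unconditionally).

§1 is the number theory (`dvd_of_totient_eq`: `φ(d) = t` bounds every `p^k ∥ d` by `p^{k-1}(p−1) ∣ t`; the three `iff`s by kernel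
decision over the divisors of `14364 = 2²·3³·7·19`, `6600 = 2³·3·5²·11`, `276 = 2²·3·23`; `φ(d) ∉ {17, 19, 21}`).  §2 the levels.  §3
**`hodgeConjectureFor_pow_or_exceptional_of_totient_le_twentyTwo`** — THE FIVE-WAY STATEMENT for every `d > 2` with `φ(d) ≤ 22`,
every `ℚ(ζ_d)`, every CM type, every realisation; `hodgeConjectureFor_pow_of_not_isSimple_of_totient_le_twentyTwo` (every NON-SIMPLE
such variety satisfies the Hodge conjecture with all its powers); `hodgeConjectureFor_pow_of_hodgeClassSpan_eq_of_totient_le_twentyTwo`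
(`B² = D²`, `B³ = D³`, `B⁴ = D⁴`, `B⁵ = D⁵` after `⊗ ℂ` suffice); `hodgeConjectureFor_or_exceptional_of_totient_le_twentyTwo` (`A` itself).

HONEST SCOPE.  The Hodge conjecture for the simple exceptional varieties themselves is NOT asserted: for `d ∈ {33, 44, 66}` it is
REDUCED (stated as an implication) to the algebraicity of the rational `(5,5)` classes of ONE Weil plane of a `10`-dimensional
Weil-type pair — Weil's open question (van Geemen 1.1); for the other exceptional levels nothing is claimed.  HC_CM is NOT proved.

## References

* [Gordon1999HodgeAVSurvey] B. B. Gordon (1999), 5.13, Thm. 6.3, Thm. 6.4, §9.3, 9.4.2 (Serre's `ℚ(ζ₁₉)` type), 9.4.3, 9.5.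
* [Kubota1965] T. Kubota, Trans. AMS 118 (1965), §4 Lemma 2.  [Dodson1984] B. Dodson, Trans. AMS 283 (1984), Thm. 3.2.1.
  [Dodson1987] B. Dodson, J. Algebra 111 (1987), Prop. 4.4 (1), Remark 4.7.  [Hazama2003CyclicCM] F. Hazama (2003), Thm. 4.8.
* [vanGeemen1994HodgeAV] B. van Geemen, LNM 1594 (1994), 1.1, 4.7, Thm. 6.12.  [Shimura1998] G. Shimura (1998), §8.2 Prop. 26.
* [Washington1997] L. C. Washington, *Introduction to Cyclotomic Fields*, Ch. 2 (Thm. 2.5, Prop. 2.2).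
-/

noncomputable section

open scoped Classical
open NumberField CategoryTheory CategoryTheory.Limits
-- `open scoped`: the tree's action of `Aut(ℂ)` on `Hom(K, ℂ)` by composition (`ringEquivCompAction`) is a scoped instance
open scoped Literature.NumberTheory.ComplexMultiplication

namespace Literature.AlgebraicGeometry.ComplexMultiplication.CyclotomicDegreeLeTwentyTwo

open Literature.AlgebraicTopology.SingularHomology
open Literature.AlgebraicGeometry.Motives (CMType AbelianVariety)
open Literature.AlgebraicGeometry.HodgeTheory
open Literature.AlgebraicGeometry.VanGeemen1994 (hodgeClassSpan)
open Literature.Barriers.HodgeConjecture (divisorClassesSpan)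
open Literature.NumberTheory.ComplexMultiplication (IsPrimitive)
open Literature.AlgebraicGeometry.Pohlmann1968 (cmTypeRank IsNondegenerate isNondegenerate_iff
  isNondegenerate_iff_forall_pow_hodgeClassSpan_eq forall_pow_hodgeClassSpan_eq_iff_forall_hodgeClassSpan_eq)
open Literature.AlgebraicGeometry.ComplexMultiplication (IsCMTypeRealisation isSimple_iff_isPrimitive)
open Literature.AlgebraicGeometry.ComplexMultiplication.CyclicTwoPowerTimesPrime (hodgeClassSpan_pow_eq_divisorClassesSpan_of_isCyclotomicExtension
  hodgeConjectureFor_pow_of_isCyclotomicExtension)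
open Literature.AlgebraicGeometry.ComplexMultiplication.NonCyclicFourTimesPrime (hodgeClassSpan_pow_eq_or_weilType_of_isCyclotomicExtension
  cm_abelian_not_isCyclic_finrank_of_isCyclotomicExtension)
open Literature.AlgebraicGeometry.Pohlmann1968.CyclicPrimeSquare (hodgeConjectureFor_pow_or_exceptional_nineteen
  hodgeConjectureFor_pow_or_exceptional_twentySeven)
open Literature.Geometry.Kaehler.ComplexTorus (hodgeConjectureFor_pow_or_exceptional_of_totient_le_sixteen)
open Literature.NumberTheory.Automorphic.Arthur2013.Leaves.TECR.TorusDict (isCyclotomicExtension_of_two_mul_of_odd)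

/-! ## §1 `φ(d) ∈ {18, 20, 22}` -/

/-- **`φ(d) = t > 0` bounds `d`**: every `p^k ∥ d` has `φ(p^k) = p^{k-1}(p − 1) ∣ t`, so `p ≤ t + 1`, `k ≤ t + 1`, and `d ∣ B` as soon
as `B` absorbs all such prime powers (a finite check). [cite: Washington1997, Ch. 2] -/
theorem dvd_of_totient_eq {d t B : ℕ} (ht : Nat.totient d = t) (h0 : 0 < t) (hB0 : 0 < B)
    (hB : ∀ p < t + 2, ∀ k < t + 2, p.Prime → 0 < k → p ^ (k - 1) * (p - 1) ∣ t → p ^ k ∣ B) : d ∣ B := by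
  have hd0 : d ≠ 0 := by rintro rfl; rw [Nat.totient_zero] at ht; omega
  rw [← Nat.factorization_le_iff_dvd hd0 hB0.ne', Finsupp.le_def]
  intro p
  by_cases hp : p.Prime
  swap
  · rw [Nat.factorization_eq_zero_of_not_prime d hp]; exact Nat.zero_le _
  set k := d.factorization p with hk
  rcases Nat.eq_zero_or_pos k with hk0 | hkpos
  · rw [hk0]; exact Nat.zero_le _
  have hpk : p ^ k ∣ d := Nat.ordProj_dvd d p
  have hφ : p ^ (k - 1) * (p - 1) ∣ t := by
    rw [← Nat.totient_prime_pow hp hkpos, ← ht]; exact Nat.totient_dvd_of_dvd hpk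
  have hp1 : p - 1 ∣ t := (Dvd.intro_left _ rfl).trans hφ
  have hplt : p < t + 2 := by have := Nat.le_of_dvd h0 hp1; omega
  have hpow : p ^ (k - 1) ∣ t := (Dvd.intro _ rfl).trans hφ
  have hklt : k < t + 2 := by
    have h1 := Nat.le_of_dvd h0 hpow
    have h2 : k - 1 < p ^ (k - 1) := Nat.lt_pow_self hp.one_lt
    omega
  rw [← hp.pow_dvd_iff_le_factorization hB0.ne']
  exact hB p hplt k hklt hp hkpos hφ

set_option maxRecDepth 100000 in
/-- **`φ(d) = 18 ⟺ d ∈ {19, 27, 38, 54}`** (`d ∣ 14364 = 2²·3³·7·19`, then inspection of its `48` divisors by kernel decision).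
[cite: Washington1997, Ch. 2] -/
theorem totient_eq_eighteen_iff {d : ℕ} : Nat.totient d = 18 ↔ d = 19 ∨ d = 27 ∨ d = 38 ∨ d = 54 := by
  refine ⟨fun h => ?_, ?_⟩
  · have hdvd : d ∣ 14364 := dvd_of_totient_eq h (by norm_num) (by norm_num) (by decide +kernel)
    have hmem : d ∈ Nat.divisors 14364 := Nat.mem_divisors.2 ⟨hdvd, by norm_num⟩
    have key : ∀ x ∈ Nat.divisors 14364, Nat.totient x = 18 → x = 19 ∨ x = 27 ∨ x = 38 ∨ x = 54 := by decide +kernel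
    exact key d hmem h
  · rintro (rfl | rfl | rfl | rfl) <;> decide +kernel

set_option maxRecDepth 100000 in
/-- **`φ(d) = 20 ⟺ d ∈ {25, 33, 44, 50, 66}`** (`d ∣ 6600 = 2³·3·5²·11`). [cite: Washington1997, Ch. 2] -/
theorem totient_eq_twenty_iff {d : ℕ} : Nat.totient d = 20 ↔ d = 25 ∨ d = 33 ∨ d = 44 ∨ d = 50 ∨ d = 66 := by
  refine ⟨fun h => ?_, ?_⟩
  · have hdvd : d ∣ 6600 := dvd_of_totient_eq h (by norm_num) (by norm_num) (by decide +kernel)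
    have hmem : d ∈ Nat.divisors 6600 := Nat.mem_divisors.2 ⟨hdvd, by norm_num⟩
    have key : ∀ x ∈ Nat.divisors 6600, Nat.totient x = 20 → x = 25 ∨ x = 33 ∨ x = 44 ∨ x = 50 ∨ x = 66 := by decide +kernel
    exact key d hmem h
  · rintro (rfl | rfl | rfl | rfl | rfl) <;> decide +kernel

set_option maxRecDepth 100000 in
/-- **`φ(d) = 22 ⟺ d ∈ {23, 46}`** (`d ∣ 276 = 2²·3·23`). [cite: Washington1997, Ch. 2] -/
theorem totient_eq_twentyTwo_iff {d : ℕ} : Nat.totient d = 22 ↔ d = 23 ∨ d = 46 := by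
  refine ⟨fun h => ?_, ?_⟩
  · have hdvd : d ∣ 276 := dvd_of_totient_eq h (by norm_num) (by norm_num) (by decide +kernel)
    have hmem : d ∈ Nat.divisors 276 := Nat.mem_divisors.2 ⟨hdvd, by norm_num⟩
    have key : ∀ x ∈ Nat.divisors 276, Nat.totient x = 22 → x = 23 ∨ x = 46 := by decide +kernel
    exact key d hmem h
  · rintro (rfl | rfl) <;> decide +kernel

set_option maxRecDepth 100000 in
/-- **`φ(d) ∉ {17, 19, 21}`** for `d > 2` (`φ` is even there), so `16 < φ(d) ≤ 22` means `φ(d) ∈ {18, 20, 22}`. [cite: Washington1997, Ch. 2] -/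
theorem totient_eq_or_of_lt_of_le {d : ℕ} (hd : 2 < d) (h16 : 16 < Nat.totient d) (h22 : Nat.totient d ≤ 22) :
    Nat.totient d = 18 ∨ Nat.totient d = 20 ∨ Nat.totient d = 22 := by
  obtain ⟨r, hr⟩ := Nat.totient_even hd
  omega

/-- **The levels of `16 < φ(d) ≤ 22`: `d ∈ {19, 27, 38, 54, 25, 33, 44, 50, 66, 23, 46}`.** [cite: Washington1997, Ch. 2] -/
theorem eq_of_lt_totient_le {d : ℕ} (hd : 2 < d) (h16 : 16 < Nat.totient d) (h22 : Nat.totient d ≤ 22) :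
    (d = 19 ∨ d = 27 ∨ d = 38 ∨ d = 54) ∨ (d = 25 ∨ d = 50) ∨ (d = 33 ∨ d = 44 ∨ d = 66) ∨ (d = 23 ∨ d = 46) := by
  rcases totient_eq_or_of_lt_of_le hd h16 h22 with h | h | h
  · exact Or.inl (totient_eq_eighteen_iff.1 h)
  · rcases totient_eq_twenty_iff.1 h with h' | h' | h' | h' | h'
    · exact Or.inr (Or.inl (Or.inl h'))
    · exact Or.inr (Or.inr (Or.inl (Or.inl h')))
    · exact Or.inr (Or.inr (Or.inl (Or.inr (Or.inl h'))))
    · exact Or.inr (Or.inl (Or.inr h'))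
    · exact Or.inr (Or.inr (Or.inl (Or.inr (Or.inr h'))))
  · exact Or.inr (Or.inr (Or.inr (totient_eq_twentyTwo_iff.1 h)))

/-! ## §2 The levels -/

section Levels

variable {q : ℕ} {K : Type} [Field K] [NumberField K]
  {A : AbelianVariety ℂ} {ι : 𝓞 K →+* End A} {θ : K →+* Module.End ℂ (complexBetti A.X 1)}

/-- **Cyclic levels of order `2^{k+1}·p`: `B•(Aⁿ) ⊗ ℂ = D•(Aⁿ) ⊗ ℂ` and the Hodge conjecture for every power, every type, every
realisation** (the lane's `CyclicTwoPowerTimesPrimeCMTypes`, BY NAME). [cite: Kubota1965, §4 Lemma 2] [cite: Gordon1999HodgeAVSurvey, Thm. 6.4 and §9.3] -/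
theorem hodgeClassSpan_pow_eq_and_hodgeConjectureFor_pow_of_isCyclic {k p : ℕ} [NeZero q] (hK : IsCyclotomicExtension {q} ℚ K)
    (h2q : 2 < q) (hcycq : IsCyclic (ZMod q)ˣ) (hφ : Nat.totient q = 2 ^ (k + 1) * p) (hp : p.Prime) (hp2 : p ≠ 2) (Φ : CMType K)
    (hA : IsCMTypeRealisation Φ A ι θ) :
    (∀ n m : ℕ, hodgeClassSpan (⨁ fun _ : Fin n => A).dim (⨁ fun _ : Fin n => A).X m =
        divisorClassesSpan (⨁ fun _ : Fin n => A).X (⨁ fun _ : Fin n => A).dim m) ∧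
      ∀ n : ℕ, HodgeConjectureFor (⨁ fun _ : Fin n => A).dim (⨁ fun _ : Fin n => A).X :=
  ⟨fun n m => hodgeClassSpan_pow_eq_divisorClassesSpan_of_isCyclotomicExtension h2q hcycq hφ hp hp2 hA n m,
    fun n => hodgeConjectureFor_pow_of_isCyclotomicExtension h2q hcycq hφ hp hp2 hA n⟩

/-- `(ℤ/23)ˣ`, `(ℤ/46)ˣ`, `(ℤ/25)ˣ`, `(ℤ/50)ˣ` are cyclic. [folklore] -/
private theorem isCyclic_units_levels :
    IsCyclic (ZMod 23)ˣ ∧ IsCyclic (ZMod 46)ˣ ∧ IsCyclic (ZMod 25)ˣ ∧ IsCyclic (ZMod 50)ˣ := by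
  have h23 : IsCyclic (ZMod 23)ˣ := ZMod.isCyclic_units_prime (by norm_num)
  have h25 : IsCyclic (ZMod 25)ˣ := ZMod.isCyclic_units_of_prime_pow 5 (by norm_num) (by norm_num) 2
  exact ⟨h23, (ZMod.isCyclic_units_two_mul_iff_of_odd 23 (by decide)).2 h23, h25,
    (ZMod.isCyclic_units_two_mul_iff_of_odd 25 (by decide)).2 h25⟩

/-- **`ℚ(ζ₂₃)`, `ℚ(ζ₄₆)` (`φ = 22 = 2·11`) and `ℚ(ζ₂₅)`, `ℚ(ζ₅₀)` (`φ = 20 = 2²·5`): all powers, every type, unconditionally.**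
[cite: Kubota1965, §4 Lemma 2] [cite: Gordon1999HodgeAVSurvey, Thm. 6.3–6.4 and §9.3] -/
theorem hodgeClassSpan_pow_eq_and_hodgeConjectureFor_pow_of_mem (hK : IsCyclotomicExtension {q} ℚ K)
    (hq : q = 23 ∨ q = 46 ∨ q = 25 ∨ q = 50) (Φ : CMType K) (hA : IsCMTypeRealisation Φ A ι θ) :
    (∀ n m : ℕ, hodgeClassSpan (⨁ fun _ : Fin n => A).dim (⨁ fun _ : Fin n => A).X m =
        divisorClassesSpan (⨁ fun _ : Fin n => A).X (⨁ fun _ : Fin n => A).dim m) ∧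
      ∀ n : ℕ, HodgeConjectureFor (⨁ fun _ : Fin n => A).dim (⨁ fun _ : Fin n => A).X := by
  obtain ⟨h23, h46, h25, h50⟩ := isCyclic_units_levels
  rcases hq with rfl | rfl | rfl | rfl
  · exact hodgeClassSpan_pow_eq_and_hodgeConjectureFor_pow_of_isCyclic (k := 0) (p := 11) hK (by norm_num) h23 (by decide +kernel)
      (by norm_num) (by norm_num) Φ hA
  · exact hodgeClassSpan_pow_eq_and_hodgeConjectureFor_pow_of_isCyclic (k := 0) (p := 11) hK (by norm_num) h46 (by decide +kernel)
      (by norm_num) (by norm_num) Φ hA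
  · exact hodgeClassSpan_pow_eq_and_hodgeConjectureFor_pow_of_isCyclic (k := 1) (p := 5) hK (by norm_num) h25 (by decide +kernel)
      (by norm_num) (by norm_num) Φ hA
  · exact hodgeClassSpan_pow_eq_and_hodgeConjectureFor_pow_of_isCyclic (k := 1) (p := 5) hK (by norm_num) h50 (by decide +kernel)
      (by norm_num) (by norm_num) Φ hA

/-- **`ℚ(ζ₁₉) = ℚ(ζ₃₈)`, `ℚ(ζ₂₇) = ℚ(ζ₅₄)` (`φ = 18`, Dodson's dimension `9`): all powers with `B• = D•`, or simple of dimension `9` and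
rank `8` with a rational `(3,3)`-class outside `D³ ⊗ ℂ`** (the tree's `CyclicPrimeSquare` §8, BY NAME). [cite: Dodson1987, Prop. 4.4 (1) and Remark 4.7]
[cite: Gordon1999HodgeAVSurvey, 9.4.2, Thm. 6.4 and 9.2.2] -/
theorem hodgeConjectureFor_pow_or_exceptional_of_totient_eq_eighteen (hK : IsCyclotomicExtension {q} ℚ K)
    (hq : q = 19 ∨ q = 27 ∨ q = 38 ∨ q = 54) (Φ : CMType K) (hA : IsCMTypeRealisation Φ A ι θ) :
    ((∀ n m : ℕ, hodgeClassSpan (⨁ fun _ : Fin n => A).dim (⨁ fun _ : Fin n => A).X m =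
        divisorClassesSpan (⨁ fun _ : Fin n => A).X (⨁ fun _ : Fin n => A).dim m) ∧
      ∀ n : ℕ, HodgeConjectureFor (⨁ fun _ : Fin n => A).dim (⨁ fun _ : Fin n => A).X) ∨
    (A.IsSimple ∧ A.dim = 9 ∧ cmTypeRank Φ = 8 ∧ hodgeClassSpan 9 A.X 3 ≠ divisorClassesSpan A.X 9 3 ∧
      ∃ c : complexBetti A.X 6, IsRationalClass c ∧ IsOfHodgeType 9 A.X 6 3 3 c ∧ c ∉ divisorClassesSpan A.X 9 3) := by
  have conv : ∀ {L : Type} [Field L] [NumberField L] (Ψ : CMType L) {B : AbelianVariety ℂ} {ι' : 𝓞 L →+* End B}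
      {θ' : L →+* Module.End ℂ (complexBetti B.X 1)}, IsCMTypeRealisation Ψ B ι' θ' →
      (B.IsSimple ∧ B.dim = 9 ∧ cmTypeRank Ψ = 8 ∧
        ∃ c : complexBetti B.X 6, IsRationalClass c ∧ IsOfHodgeType 9 B.X 6 3 3 c ∧ c ∉ divisorClassesSpan B.X 9 3) →
      (B.IsSimple ∧ B.dim = 9 ∧ cmTypeRank Ψ = 8 ∧ hodgeClassSpan 9 B.X 3 ≠ divisorClassesSpan B.X 9 3 ∧
        ∃ c : complexBetti B.X 6, IsRationalClass c ∧ IsOfHodgeType 9 B.X 6 3 3 c ∧ c ∉ divisorClassesSpan B.X 9 3) := by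
    intro L _ _ Ψ B ι' θ' _ ⟨hS, hdim, hr, c, hcQ, hcH, hcD⟩
    exact ⟨hS, hdim, hr, fun h => hcD (h ▸ Submodule.subset_span ⟨hcQ, hcH⟩), c, hcQ, hcH, hcD⟩
  rcases hq with rfl | rfl | rfl | rfl
  · haveI := hK
    rcases (hodgeConjectureFor_pow_or_exceptional_nineteen Φ hA).1 with h | h
    · exact Or.inl h
    · exact Or.inr (conv Φ hA h)
  · haveI := hK
    rcases (hodgeConjectureFor_pow_or_exceptional_twentySeven Φ hA).1 with h | h
    · exact Or.inl h
    · exact Or.inr (conv Φ hA h)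
  · haveI : IsCyclotomicExtension {2 * 19} ℚ K := hK
    haveI : IsCyclotomicExtension {19} ℚ K := isCyclotomicExtension_of_two_mul_of_odd (K := K) (by decide)
    rcases (hodgeConjectureFor_pow_or_exceptional_nineteen Φ hA).1 with h | h
    · exact Or.inl h
    · exact Or.inr (conv Φ hA h)
  · haveI : IsCyclotomicExtension {2 * 27} ℚ K := hK
    haveI : IsCyclotomicExtension {27} ℚ K := isCyclotomicExtension_of_two_mul_of_odd (K := K) (by decide)
    rcases (hodgeConjectureFor_pow_or_exceptional_twentySeven Φ hA).1 with h | h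
    · exact Or.inl h
    · exact Or.inr (conv Φ hA h)

/-- `(ℤ/33)ˣ`, `(ℤ/44)ˣ`, `(ℤ/66)ˣ` are not cyclic. [folklore] -/
private theorem not_isCyclic_units_levels :
    ¬ IsCyclic (ZMod 33)ˣ ∧ ¬ IsCyclic (ZMod 44)ˣ ∧ ¬ IsCyclic (ZMod 66)ˣ := by
  have h33 : ¬ IsCyclic (ZMod 33)ˣ :=
    ZMod.not_isCyclic_units_of_mul_coprime 3 11 (by decide) (by norm_num) (by decide) (by norm_num) (by norm_num)
  refine ⟨h33, fun h => ?_, fun h => h33 ((ZMod.isCyclic_units_two_mul_iff_of_odd 33 (by decide)).1 h)⟩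
  rcases (ZMod.isCyclic_units_four_mul_iff 11).1 h with h11 | h11 <;> omega

/-- **`ℚ(ζ₃₃) = ℚ(ζ₆₆)`, `ℚ(ζ₄₄)` (`φ = 20`, Galois group `ℤ/2 × ℤ/10`): all powers with `B• = D•`, or SIMPLE of dimension `10` with
`B⁵(A) ⊗ ℂ ≠ D⁵(A) ⊗ ℂ`, `Bᵐ(A) ⊗ ℂ = Dᵐ(A) ⊗ ℂ` for all `m ≠ 5`, `(A, ι w)` of Weil type `(5, d')` for some `w = √-d' ∈ 𝓞_K`,
`B⁵(A) ⊗ ℂ = D⁵(A) ⊗ ℂ ⊔ W ⊗ ℂ`, and the Hodge conjecture for `A` and all `Aⁿ` implied by the algebraicity of the rational `(5,5)` classes of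
that one Weil plane** (the lane's `NonCyclicFourTimesPrime` trichotomy BY NAME, sharpened by Hazama's criterion: degenerate primitive
⟹ an exceptional class on `A` itself, which by `B^{≠5} = D^{≠5}` sits in degree `5`). [cite: Gordon1999HodgeAVSurvey, 5.13 and Thm. 6.4 and 9.5]
[cite: vanGeemen1994HodgeAV, 4.7 and Thm. 6.12 and 1.1] [cite: Hazama2003CyclicCM, Thm. 4.8 and Rem. 4.10] -/
theorem hodgeConjectureFor_pow_or_weilType_of_totient_eq_twenty (hK : IsCyclotomicExtension {q} ℚ K)
    (hq : q = 33 ∨ q = 44 ∨ q = 66) (Φ : CMType K) (hA : IsCMTypeRealisation Φ A ι θ) :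
    ((∀ n m : ℕ, hodgeClassSpan (⨁ fun _ : Fin n => A).dim (⨁ fun _ : Fin n => A).X m =
        divisorClassesSpan (⨁ fun _ : Fin n => A).X (⨁ fun _ : Fin n => A).dim m) ∧
      ∀ n : ℕ, HodgeConjectureFor (⨁ fun _ : Fin n => A).dim (⨁ fun _ : Fin n => A).X) ∨
    (A.IsSimple ∧ A.dim = 10 ∧ cmTypeRank Φ = 10 ∧ hodgeClassSpan 10 A.X 5 ≠ divisorClassesSpan A.X 10 5 ∧
      (∀ m : ℕ, m ≠ 5 → hodgeClassSpan 10 A.X m = divisorClassesSpan A.X 10 m) ∧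
      ∃ (w : 𝓞 K) (d' : ℕ), 0 < d' ∧ w ^ 2 = -(d' : 𝓞 K) ∧ IsWeilType A (ι w) 5 d' ∧ IsDivisorWeilGenerated A (ι w) 5 d' ∧
        hodgeClassSpan 10 A.X 5 = divisorClassesSpan A.X 10 5 ⊔ weilClassesOf A (ι w) 5 d' ∧
        ((∀ c ∈ weilClassesOf A (ι w) 5 d', IsRationalClass c → IsOfHodgeType 10 A.X 10 5 5 c → c ∈ algebraicClasses A.X 5) →
          HodgeConjectureFor A.dim A.X ∧ ∀ n : ℕ, HodgeConjectureFor (⨁ fun _ : Fin n => A).dim (⨁ fun _ : Fin n => A).X)) := by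
  obtain ⟨h33, h44, h66⟩ := not_isCyclic_units_levels
  -- one argument for the three levels
  have key : ∀ (hq0 : NeZero q) (h2q : 2 < q) (hncq : ¬ IsCyclic (ZMod q)ˣ) (hφ : Nat.totient q = 4 * 5),
      ((∀ n m : ℕ, hodgeClassSpan (⨁ fun _ : Fin n => A).dim (⨁ fun _ : Fin n => A).X m =
          divisorClassesSpan (⨁ fun _ : Fin n => A).X (⨁ fun _ : Fin n => A).dim m) ∧
        ∀ n : ℕ, HodgeConjectureFor (⨁ fun _ : Fin n => A).dim (⨁ fun _ : Fin n => A).X) ∨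
      (A.IsSimple ∧ A.dim = 10 ∧ cmTypeRank Φ = 10 ∧ hodgeClassSpan 10 A.X 5 ≠ divisorClassesSpan A.X 10 5 ∧
        (∀ m : ℕ, m ≠ 5 → hodgeClassSpan 10 A.X m = divisorClassesSpan A.X 10 m) ∧
        ∃ (w : 𝓞 K) (d' : ℕ), 0 < d' ∧ w ^ 2 = -(d' : 𝓞 K) ∧ IsWeilType A (ι w) 5 d' ∧ IsDivisorWeilGenerated A (ι w) 5 d' ∧
          hodgeClassSpan 10 A.X 5 = divisorClassesSpan A.X 10 5 ⊔ weilClassesOf A (ι w) 5 d' ∧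
          ((∀ c ∈ weilClassesOf A (ι w) 5 d', IsRationalClass c → IsOfHodgeType 10 A.X 10 5 5 c → c ∈ algebraicClasses A.X 5) →
            HodgeConjectureFor A.dim A.X ∧ ∀ n : ℕ, HodgeConjectureFor (⨁ fun _ : Fin n => A).dim (⨁ fun _ : Fin n => A).X)) := by
    intro hq0 h2q hncq hφ
    haveI := hK
    obtain ⟨hcm, hab, -, hL⟩ := cm_abelian_not_isCyclic_finrank_of_isCyclotomicExtension h2q hncq K
    haveI := hcm; haveI := hab
    have hdim : A.dim = 10 := by
      have h : A.dim = Module.finrank ℚ K / 2 := Motives.schemeDim_eq_holds hA.1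
      rw [h, hL, hφ]
    rcases hodgeClassSpan_pow_eq_or_weilType_of_isCyclotomicExtension (p := 5) h2q hncq hφ (by norm_num) (by norm_num) hA with
      h | ⟨hS, hr, hΦ, hoff, k, w, d', -, -, -, hd, hw2, hWT, hDW, hsup, hHC⟩
    · exact Or.inl h
    · right
      rw [hdim] at hoff hsup
      obtain ⟨φ₀⟩ : Nonempty (K →+* ℂ) := inferInstance
      have hprim : IsPrimitive (ℂ ≃+* ℂ) Φ.1 φ₀ := (isSimple_iff_isPrimitive hA φ₀).1 hS
      -- Hazama's criterion: `Φ` degenerate ⟹ NOT all `Bᵐ(A) = Dᵐ(A)`; off degree `5` they agree, so `B⁵ ≠ D⁵`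
      have hne : hodgeClassSpan 10 A.X 5 ≠ divisorClassesSpan A.X 10 5 := by
        intro h5
        have hall : ∀ m : ℕ, hodgeClassSpan (Module.finrank ℚ K / 2) A.X m = divisorClassesSpan A.X (Module.finrank ℚ K / 2) m := by
          intro m
          rw [hL, hφ]
          by_cases hm : m = 5
          · rw [hm]; exact h5
          · exact hoff m hm
        exact hΦ ((isNondegenerate_iff_forall_pow_hodgeClassSpan_eq φ₀ hprim hA).2
          ((forall_pow_hodgeClassSpan_eq_iff_forall_hodgeClassSpan_eq hA).2 hall))
      refine ⟨hS, hdim, hr, hne, hoff, w, d', hd, hw2, hWT, hDW, hsup, fun hW => ?_⟩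
      exact hHC (by simpa only [hdim] using hW)
  rcases hq with rfl | rfl | rfl
  · exact key inferInstance (by norm_num) h33 (by decide +kernel)
  · exact key inferInstance (by norm_num) h44 (by decide +kernel)
  · exact key inferInstance (by norm_num) h66 (by decide +kernel)

end Levels

/-! ## §3 `φ(d) ≤ 22`, complete -/

section Complete

variable {d : ℕ} {K : Type} [Field K] [NumberField K]
  {A : AbelianVariety ℂ} {ι : 𝓞 K →+* End A} {θ : K →+* Module.End ℂ (complexBetti A.X 1)}

/-- **THE CM ABELIAN VARIETIES OF THE CYCLOTOMIC FIELDS OF DEGREE `≤ 22`, COMPLETE.**  Let `d > 2`, `φ(d) ≤ 22`, `K = ℚ(ζ_d)`, `Φ` ANY CM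
type of `K`, `(A, ι, θ)` ANY realisation.  Then EITHER `B•(Aⁿ) ⊗ ℂ = D•(Aⁿ) ⊗ ℂ` for all `n` and the Hodge conjecture holds for every power of
`A` (UNCONDITIONALLY), OR `A` is SIMPLE and one of: (a) `d ∈ {21, 28, 36, 42}`, `dim A = 6`, `B³ ≠ D³`; (b) `d ∈ {32, 40, 48, 60}`,
`dim A = 8`, `B⁴ ≠ D⁴` or `B² ≠ D²`; (c) `d ∈ {19, 27, 38, 54}`, `dim A = 9`, rank `8`, `B³ ≠ D³`; (d) `d ∈ {33, 44, 66}`, `dim A = 10`,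
rank `10`, `B⁵ ≠ D⁵` but `Bᵐ = Dᵐ` for all `m ≠ 5`, Weil type `(5, d')` for some `√-d' ∈ 𝓞_K`, and HC for `A` and all `Aⁿ` GRANTED the
rational `(5,5)` Weil classes of that one plane (all `⊗ ℂ`). [cite: Gordon1999HodgeAVSurvey, 5.13, Thm. 6.3–6.4, §9.3, 9.4.2–9.4.3 and 9.5]
[cite: Dodson1984, Thm. 3.2.1] [cite: Dodson1987, Prop. 4.4 (1) and Remark 4.7] [cite: Kubota1965, §4 Lemma 2] [cite: vanGeemen1994HodgeAV, Thm. 6.12] -/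
theorem hodgeConjectureFor_pow_or_exceptional_of_totient_le_twentyTwo (hK : IsCyclotomicExtension {d} ℚ K) (hd : 2 < d)
    (h22 : Nat.totient d ≤ 22) (Φ : CMType K) (hA : IsCMTypeRealisation Φ A ι θ) :
    ((∀ n m : ℕ, hodgeClassSpan (⨁ fun _ : Fin n => A).dim (⨁ fun _ : Fin n => A).X m =
        divisorClassesSpan (⨁ fun _ : Fin n => A).X (⨁ fun _ : Fin n => A).dim m) ∧
      ∀ n : ℕ, HodgeConjectureFor (⨁ fun _ : Fin n => A).dim (⨁ fun _ : Fin n => A).X) ∨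
    ((d = 21 ∨ d = 28 ∨ d = 36 ∨ d = 42) ∧ A.IsSimple ∧ A.dim = 6 ∧ hodgeClassSpan 6 A.X 3 ≠ divisorClassesSpan A.X 6 3) ∨
    ((d = 32 ∨ d = 40 ∨ d = 48 ∨ d = 60) ∧ A.IsSimple ∧ A.dim = 8 ∧
      (hodgeClassSpan 8 A.X 4 ≠ divisorClassesSpan A.X 8 4 ∨ hodgeClassSpan 8 A.X 2 ≠ divisorClassesSpan A.X 8 2)) ∨
    ((d = 19 ∨ d = 27 ∨ d = 38 ∨ d = 54) ∧ A.IsSimple ∧ A.dim = 9 ∧ cmTypeRank Φ = 8 ∧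
      hodgeClassSpan 9 A.X 3 ≠ divisorClassesSpan A.X 9 3 ∧
      ∃ c : complexBetti A.X 6, IsRationalClass c ∧ IsOfHodgeType 9 A.X 6 3 3 c ∧ c ∉ divisorClassesSpan A.X 9 3) ∨
    ((d = 33 ∨ d = 44 ∨ d = 66) ∧ A.IsSimple ∧ A.dim = 10 ∧ cmTypeRank Φ = 10 ∧
      hodgeClassSpan 10 A.X 5 ≠ divisorClassesSpan A.X 10 5 ∧ (∀ m : ℕ, m ≠ 5 → hodgeClassSpan 10 A.X m = divisorClassesSpan A.X 10 m) ∧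
      ∃ (w : 𝓞 K) (d' : ℕ), 0 < d' ∧ w ^ 2 = -(d' : 𝓞 K) ∧ IsWeilType A (ι w) 5 d' ∧ IsDivisorWeilGenerated A (ι w) 5 d' ∧
        hodgeClassSpan 10 A.X 5 = divisorClassesSpan A.X 10 5 ⊔ weilClassesOf A (ι w) 5 d' ∧
        ((∀ c ∈ weilClassesOf A (ι w) 5 d', IsRationalClass c → IsOfHodgeType 10 A.X 10 5 5 c → c ∈ algebraicClasses A.X 5) →
          HodgeConjectureFor A.dim A.X ∧ ∀ n : ℕ, HodgeConjectureFor (⨁ fun _ : Fin n => A).dim (⨁ fun _ : Fin n => A).X)) := by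
  by_cases h16 : Nat.totient d ≤ 16
  · rcases hodgeConjectureFor_pow_or_exceptional_of_totient_le_sixteen hK hd h16 Φ hA with h | h | h
    · exact Or.inl h
    · exact Or.inr (Or.inl h)
    · exact Or.inr (Or.inr (Or.inl h))
  · rcases eq_of_lt_totient_le hd (by omega) h22 with hq | hq | hq | hq
    · rcases hodgeConjectureFor_pow_or_exceptional_of_totient_eq_eighteen hK hq Φ hA with h | h
      · exact Or.inl h
      · exact Or.inr (Or.inr (Or.inr (Or.inl ⟨hq, h⟩)))
    · have hq' : d = 23 ∨ d = 46 ∨ d = 25 ∨ d = 50 := by rcases hq with h | h <;> simp [h]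
      exact Or.inl (hodgeClassSpan_pow_eq_and_hodgeConjectureFor_pow_of_mem hK hq' Φ hA)
    · rcases hodgeConjectureFor_pow_or_weilType_of_totient_eq_twenty hK hq Φ hA with h | h
      · exact Or.inl h
      · exact Or.inr (Or.inr (Or.inr (Or.inr ⟨hq, h⟩)))
    · have hq' : d = 23 ∨ d = 46 ∨ d = 25 ∨ d = 50 := by rcases hq with h | h <;> simp [h]
      exact Or.inl (hodgeClassSpan_pow_eq_and_hodgeConjectureFor_pow_of_mem hK hq' Φ hA)

/-- **Every NON-SIMPLE abelian variety with complex multiplication by a cyclotomic field of degree `≤ 22` satisfies the Hodge conjecture with all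
its powers** (and `B• = D•` on all of them), unconditionally. [cite: Gordon1999HodgeAVSurvey, Thm. 6.3–6.4 and §9.3] [cite: Shimura1998, §8.2 Prop. 26] -/
theorem hodgeConjectureFor_pow_of_not_isSimple_of_totient_le_twentyTwo (hK : IsCyclotomicExtension {d} ℚ K) (hd : 2 < d)
    (h22 : Nat.totient d ≤ 22) (Φ : CMType K) (hA : IsCMTypeRealisation Φ A ι θ) (hns : ¬ A.IsSimple) (n : ℕ) :
    (∀ m : ℕ, hodgeClassSpan (⨁ fun _ : Fin n => A).dim (⨁ fun _ : Fin n => A).X m =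
        divisorClassesSpan (⨁ fun _ : Fin n => A).X (⨁ fun _ : Fin n => A).dim m) ∧
      HodgeConjectureFor (⨁ fun _ : Fin n => A).dim (⨁ fun _ : Fin n => A).X := by
  rcases hodgeConjectureFor_pow_or_exceptional_of_totient_le_twentyTwo hK hd h22 Φ hA with
    ⟨h1, h2⟩ | ⟨-, hS, -⟩ | ⟨-, hS, -⟩ | ⟨-, hS, -⟩ | ⟨-, hS, -⟩
  · exact ⟨h1 n, h2 n⟩
  all_goals exact absurd hS hns

/-- **`B² = D²`, `B³ = D³`, `B⁴ = D⁴` and `B⁵ = D⁵` (after `⊗ ℂ`) suffice**: an abelian variety with complex multiplication by a cyclotomic field of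
degree `≤ 22` whose Hodge classes of weights `4, 6, 8, 10` are generated by divisor classes satisfies the Hodge conjecture with all its powers.
[cite: Gordon1999HodgeAVSurvey, §9.3 and 5.13] -/
theorem hodgeConjectureFor_pow_of_hodgeClassSpan_eq_of_totient_le_twentyTwo (hK : IsCyclotomicExtension {d} ℚ K) (hd : 2 < d)
    (h22 : Nat.totient d ≤ 22) (Φ : CMType K) (hA : IsCMTypeRealisation Φ A ι θ)
    (h2 : hodgeClassSpan A.dim A.X 2 = divisorClassesSpan A.X A.dim 2) (h3 : hodgeClassSpan A.dim A.X 3 = divisorClassesSpan A.X A.dim 3)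
    (h4 : hodgeClassSpan A.dim A.X 4 = divisorClassesSpan A.X A.dim 4) (h5 : hodgeClassSpan A.dim A.X 5 = divisorClassesSpan A.X A.dim 5)
    (n : ℕ) : HodgeConjectureFor (⨁ fun _ : Fin n => A).dim (⨁ fun _ : Fin n => A).X := by
  rcases hodgeConjectureFor_pow_or_exceptional_of_totient_le_twentyTwo hK hd h22 Φ hA with
    ⟨-, h⟩ | ⟨-, -, hdim, hne⟩ | ⟨-, -, hdim, hne⟩ | ⟨-, -, hdim, -, hne, -⟩ | ⟨-, -, hdim, -, hne, -⟩
  · exact h n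
  · rw [hdim] at h3; exact absurd h3 hne
  · rw [hdim] at h4 h2
    rcases hne with hne | hne
    · exact absurd h4 hne
    · exact absurd h2 hne
  · rw [hdim] at h3; exact absurd h3 hne
  · rw [hdim] at h5; exact absurd h5 hne

/-- `Bᵐ ⊗ ℂ = Dᵐ ⊗ ℂ` for all `m` on an abelian variety gives the Hodge conjecture for it. [cite: Gordon1999HodgeAVSurvey, §9.3] -/
private theorem hodgeConjectureFor_of_forall_hodgeClassSpan_eq₆₃c (B : AbelianVariety ℂ)
    (h : ∀ m : ℕ, hodgeClassSpan B.dim B.X m = divisorClassesSpan B.X B.dim m) : HodgeConjectureFor B.dim B.X :=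
  ⟨nonempty_hodgeModel_holds (Motives.AbelianVariety.isSmoothProjective_holds (A := B)),
    fun m _ hc hmm ↦ AbelianVariety.divisorClassesSpan_le_algebraicClasses B
      (fun b hb hb' ↦ lefschetzOneOne_rational_holds (Motives.AbelianVariety.isSmoothProjective_holds (A := B)) b hb hb') m
      ((h m) ▸ Submodule.subset_span ⟨hc, hmm⟩)⟩

/-- **The variety itself**: the Hodge conjecture for `A`, or `A` is one of the simple exceptional varieties (a)–(d). [cite: Gordon1999HodgeAVSurvey, §9.3 and 5.13] -/
theorem hodgeConjectureFor_or_exceptional_of_totient_le_twentyTwo (hK : IsCyclotomicExtension {d} ℚ K) (hd : 2 < d)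
    (h22 : Nat.totient d ≤ 22) (Φ : CMType K) (hA : IsCMTypeRealisation Φ A ι θ) :
    HodgeConjectureFor A.dim A.X ∨
    (A.IsSimple ∧
      (((d = 21 ∨ d = 28 ∨ d = 36 ∨ d = 42) ∧ A.dim = 6 ∧ hodgeClassSpan 6 A.X 3 ≠ divisorClassesSpan A.X 6 3) ∨
       ((d = 32 ∨ d = 40 ∨ d = 48 ∨ d = 60) ∧ A.dim = 8 ∧
         (hodgeClassSpan 8 A.X 4 ≠ divisorClassesSpan A.X 8 4 ∨ hodgeClassSpan 8 A.X 2 ≠ divisorClassesSpan A.X 8 2)) ∨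
       ((d = 19 ∨ d = 27 ∨ d = 38 ∨ d = 54) ∧ A.dim = 9 ∧ hodgeClassSpan 9 A.X 3 ≠ divisorClassesSpan A.X 9 3) ∨
       ((d = 33 ∨ d = 44 ∨ d = 66) ∧ A.dim = 10 ∧ hodgeClassSpan 10 A.X 5 ≠ divisorClassesSpan A.X 10 5 ∧
         ∀ m : ℕ, m ≠ 5 → hodgeClassSpan 10 A.X m = divisorClassesSpan A.X 10 m))) := by
  haveI : NeZero d := ⟨by omega⟩
  haveI := hK
  haveI : IsCMField K := IsCyclotomicExtension.Rat.isCMField K (S := ({d} : Set ℕ)) ⟨d, rfl, hd⟩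
  haveI : IsAbelianGalois ℚ K := IsCyclotomicExtension.isAbelianGalois {d} ℚ K
  rcases hodgeConjectureFor_pow_or_exceptional_of_totient_le_twentyTwo hK hd h22 Φ hA with
    ⟨h1, -⟩ | ⟨hq, hS, hdim, hne⟩ | ⟨hq, hS, hdim, hne⟩ | ⟨hq, hS, hdim, -, hne, -⟩ | ⟨hq, hS, hdim, -, hne, hoff, -⟩
  · refine Or.inl (hodgeConjectureFor_of_forall_hodgeClassSpan_eq₆₃c A ?_)
    have hdim : A.dim = Module.finrank ℚ K / 2 := Motives.schemeDim_eq_holds hA.1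
    rw [hdim]
    exact (forall_pow_hodgeClassSpan_eq_iff_forall_hodgeClassSpan_eq hA).1 h1
  · exact Or.inr ⟨hS, Or.inl ⟨hq, hdim, hne⟩⟩
  · exact Or.inr ⟨hS, Or.inr (Or.inl ⟨hq, hdim, hne⟩)⟩
  · exact Or.inr ⟨hS, Or.inr (Or.inr (Or.inl ⟨hq, hdim, hne⟩))⟩
  · exact Or.inr ⟨hS, Or.inr (Or.inr (Or.inr ⟨hq, hdim, hne, hoff⟩))⟩

end Complete

end Literature.AlgebraicGeometry.ComplexMultiplication.CyclotomicDegreeLeTwentyTwo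

end
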